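import Literature.AlgebraicGeometry.HodgeTheory.WeilSurfaceCMSquareAlgebraic
import Literature.AlgebraicGeometry.Motives.AimedSplitProductDischarge
import Literature.NumberTheory.EllipticCurves.CMEndomorphismOfMulMemLattice
import HarnessLib

/-!
# `exists_weilTypeSurface_prod_isHyperbolicWeilType_all` holds

Family `hodge`, layer `Literature/AlgebraicGeometry/HodgeTheory`. DISCHARGE of the named fact
`exists_weilTypeSurface_prod_isHyperbolicWeilType_all` (file `WeilClassesDescending`; E. Markman,
arXiv:2509.23403 §11.5 Step 2 with the split criterion of Step 1, in every even dimension; B. van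
Geemen, LNM 1594, Lemma 5.2 (2)–(6), 5.3, 5.4 (5.4.1); C. Schoen, Compositio Math. 114 (1998) §10;
Landherr 1936): for `n ≥ 1`, `d ≥ 1` and a complex abelian `2n`-fold `(A₁, φ₁)`, `φ₁ ≫ φ₁ = -d`, with
a non-zero rational `(n,n)`-class in its Weil plane, there is a Weil-type abelian surface `(A₂, φ₂)`
with its Weil classes `u± ≠ 0`, `u₊ + u₋` rational of type `(1,1)`, Schoen's descent partner `t`
(algebraic, `u± ⌣ t ≠ 0`), and a projective embedding `e` of `A₁ × A₂` with a rational `a ≠ 0` for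
which `(A₁ × A₂, φ₁ × φ₂)` is of HYPERBOLIC Weil type in half-dimension `n + 1` for the
`K`-symmetrised hyperplane class `d·e^*a + (φ₁ × φ₂)^*e^*a`.

Proof (the printed one, van Geemen 5.3: the partner is the CM square). Take the CM curve
`E₀ = ℂ/(ℤ + ℤ√-d)` with `ψ₀ = [√-d]`, `ψ₀ ≫ ψ₀ = -d`
(`NumberTheory.EllipticCurves.CMEndomorphism.exists_cmCurve_sqrt_neg`, Silverman AEC VI.4.1 (b)), and
`A₂ = E₀ × E₀`, `φ₂ = ψ₀ × (-ψ₀)`. The surface conjunct — dimension, smooth projectivity, `φ₂² = -d`,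
the Weil classes `u± = pr₁^*w± ∪ pr₂^*w∓` and the descent partner — is
`exists_weilType_cmSquare_partner` (files `WeilSurfaceCMSquare`, `WeilSurfaceCMSquareAlgebraic`: purity
of `ψ₀^*`-eigenvectors in `H¹`, and algebraicity of the Weil lines of the CM square by shear
automorphisms). The aiming conjunct — the weighted Segre embedding `e` of `A₁ × (E₀ × E₀)` making the
product hyperbolic — is `Motives.aimedSplitProduct_cmSquare_of_pos` (file
`Motives/AimedSplitProductDischarge`: Hodge–Riemann in degree one with sign ⇒ signature `(n,n)`,
the degree-one model `(v, ψ₀^*v)` of the CM curve (`cmCurve_rationalModel`), Landherr's arithmetic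
`exists_isotropic_blockVectors'` via Meyer, the frame transport
`isHyperbolicWeilType_prod_of_rationalModels`, and the `K`-symmetric weighted Segre embedding of
`Motives/SegreHyperplaneClass`). No hypothesis beyond those of the fact; no definition and no named
fact is introduced (D-0026).

## References

* [Markman2025SurveySecant] E. Markman, Secant sheaves and Weil classes on abelian varieties,
  arXiv:2509.23403, §11.5 Step 1–2.
* [vanGeemen1994HodgeAV] B. van Geemen, An introduction to the Hodge conjecture for abelian
  varieties, LNM 1594 (1994), Lemma 5.2 (2)–(6), 5.3, 5.4 (5.4.1).
* [Schoen1998HodgeWeilAddendum] C. Schoen, Addendum to: Hodge classes on self-products of a variety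
  with an automorphism, Compositio Math. 114 (1998) 329–336, §10.
* [Landherr1936HermitianForms] W. Landherr, Äquivalenz Hermitescher Formen über einem beliebigen
  algebraischen Zahlkörper, Abh. Math. Sem. Hamburg 11 (1936), main theorem.
* [SilvermanAEC2009] J. H. Silverman, The Arithmetic of Elliptic Curves, 2nd ed. (2009), VI Thm. 4.1 (b).
-/

noncomputable section

open CategoryTheory

namespace Literature.AlgebraicGeometry.HodgeTheory

open Literature.AlgebraicTopology.SingularHomology
open Literature.AlgebraicGeometry.Motives

/-- **`exists_weilTypeSurface_prod_isHyperbolicWeilType_all` holds** (Markman §11.5 Step 2 in every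
even dimension; van Geemen 5.2–5.4; Schoen §10): the partner is the CM square `E₀ × E₀`,
`φ₂ = [√-d] × (-[√-d])`, with its Weil classes and descent partner
(`exists_weilType_cmSquare_partner`), and the aiming is `Motives.aimedSplitProduct_cmSquare_of_pos`.
[cite: Markman2025SurveySecant, §11.5 Step 1 (last two sentences) and Step 2 (first two sentences)]
[cite: vanGeemen1994HodgeAV, Lemma 5.2 (2)–(6), 5.3 and 5.4 (5.4.1)]
[cite: Schoen1998HodgeWeilAddendum, §10 (proof of the Proposition, p. 333)]
[cite: SilvermanAEC2009, VI Thm. 4.1 (b)] -/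
theorem exists_weilTypeSurface_prod_isHyperbolicWeilType_all_holds :
    exists_weilTypeSurface_prod_isHyperbolicWeilType_all := by
  intro n hn d hd A₁ φ₁ hA₁ _hX hφ₁ hW
  obtain ⟨E₀, ψ₀, hE, hψ⟩ :=
    Literature.NumberTheory.EllipticCurves.CMEndomorphism.exists_cmCurve_sqrt_neg d hd
  obtain ⟨h1, h2, h3, h4⟩ := exists_weilType_cmSquare_partner hE hd hψ
  obtain ⟨e, a, ha, ha0, hhyp⟩ := Motives.aimedSplitProduct_cmSquare_of_pos hd hE hψ hn hA₁ hφ₁ hW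
  exact ⟨E₀.prod E₀, _, h1, h2, h3, h4, e, a, ha, ha0, hhyp⟩

end Literature.AlgebraicGeometry.HodgeTheory

end
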